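import Literature.NumberTheory.EllipticCurves.Tian2014.CMPointSystemBridgeMaximal
import HarnessLib

/-!
# The cusp relation «`2·ϕ([i][0]) = 0`» (display M7 of the maximal bridge) as a KERNEL THEOREM of two printed sentences
# of Tian–Yuan–Zhang 2017 on their uniformisation `τ` — «`τ(1/2) = [0]`» and «`ϕ_F` and `[1+i]` have the same kernel
# `{0, τ(1)}`» (Lemma 3.16) — so that the seven displays of `CMPointSystemBridgeMaximal.lean` are all printed sentences

Cell `bsd-monsky` (typer seat, g5; referee B ROUND 253 on OFFER-M v1.4: the fourth mark `computation@phiIotaCuspTwoTorsion`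
«is REMOVABLE by the split the cell itself names (three PRINTED displays + kernel glue)»). HONEST FRAMING: nothing asserted;
every `def … : Prop` below is a displayed sentence of Tian–Yuan–Zhang 2017 (Asian J. Math. 21 (2017) 721–774; `pNNNN LMM` =
page:line of the materialised arXiv text, `J` = journal page) on abstract DATA, and the kernel theorem is four lines of
algebra in the group `A = E′(ℂ)`.

## The datum: TYZ's uniformisation `τ`

«There is an analytic isomorphism `τ : ℂ/(1+i)ℤ[i] → A(ℂ)`» (TYZ §3.2, p0011 L121–L123, J740), «unique up to
multiplication by `μ₄`», normalised by «replacing `τ` by `−τ` if necessary» so that the induced bijection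
`½ℤ[i]/(1+i)ℤ[i] → A[(1+i)³] = Γ₀(32)∖ℙ¹(ℚ)` is the printed table of cusps (p0012 L8–L18, J741). As data it is an additive
map `tau : ℂ →+ A` (`TauData`): the composite of the quotient map with the isomorphism — only its additivity is used,
nothing about its kernel or its image is displayed.

## The displays (one printed sentence each)

* `tyzTauHalf` — «`τ(1/2) = [0]`» (p0012 L16, J741; the cusp `[0]` of Tian Prop. 2.1, «`[0] = (2, 4)`», through TYZ's
  identification `i₀ : X₀(32) → A` mapping `∞` to `0`, p0012 L8–L9).
* `tyzSameKernel` — Lemma 3.16 proof: «consider the two 2-isogenies `ϕ_F : A_F → E_F`, `[1+i] : A_F → A_F`. One checks that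
  these two morphisms have the same kernel `{0, τ(1)}`» (p0017 L105–L111, J754) — displayed on complex points as
  `ker ϕ = {0, τ(1)}` and `ker (1 + [i]) = {0, τ(1)}`, where `[1+i] = [1] + [i]` is the `ℤ[i]`-module structure of `A`
  («`A(ℍ′_n)` is a `ℤ[i]`-module», p0011 L66; Tian Prop. 2.1 «complex multiplication by `ℤ[i]`») — `ϕ` is the isogeny of
  degree `2` of J751 («Let `ϕ : A → E` be the isogeny of degree 2», p0016 L45), the `phi` of `BridgeData`.

## The kernel content

`phiIotaCuspTwoTorsion_of_tauDisplays`: `2·[0] = 2·τ(1/2) = τ(1)` (additivity), `[i]τ(1) = −τ(1)` (`τ(1) ∈ ker(1 + [i])`),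
`ϕ(τ(1)) = 0` (`τ(1) ∈ ker ϕ`), hence `2·ϕ([i][0]) = ϕ([i](2·[0])) = ϕ([i]τ(1)) = −ϕ(τ(1)) = 0`. Then `CuspDisplays ⟹
MaximalDisplays`, `GrossZagierCusp ⟹ GrossZagierMaximal`, and the restated fact `tian2014_system_sMinus_cusp` (M7 replaced by
`τ` and its two printed sentences) implies `tian2014_system_sMinus_maximal`, hence every enclosure form of C-P2-1.
Nothing booked; no mark moved by this file alone.
[cite: TianYuanZhang2017, §3.2 basic facts (p0011 L119–L128, p0012 L8–L18; J740–J741), Lemma 3.16 and its proof (p0017 L98–L113; J754), J751 (p0016 L45)]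
[cite: Tian2014, Prop. 2.1 (p0006 L25–L27)]
-/

noncomputable section

open scoped Classical

open WeierstrassCurve NumberField Literature.NumberTheory.EllipticCurves
  Literature.NumberTheory.EllipticCurves.TianYuanZhang2017

namespace Literature.NumberTheory.EllipticCurves.Tian2014

namespace CMPointData

variable {n : ℕ}

namespace BridgeData

variable {D : CMPointData n} (B : D.BridgeData)

/-! ## §1 The datum `τ` -/

/-- **TYZ's uniformisation `τ` as data** (objects only; nothing asserted): «There is an analytic isomorphism
`τ : ℂ/(1+i)ℤ[i] → A(ℂ)`», normalised as in TYZ §3.2 («replacing `τ` by `−τ` if necessary»), read as the additive map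
`ℂ → A` (the quotient map followed by the isomorphism). Only additivity is recorded; kernel and image are not displayed.
[cite: TianYuanZhang2017, §3.2 basic facts (p0011 L121–L128, p0012 L8–L13; J740–J741)] -/
structure TauData : Type where
  /-- the uniformisation `τ : ℂ → A(ℂ)` (through `ℂ/(1+i)ℤ[i]`), as an additive map -/
  tau : ℂ →+ B.A

namespace TauData

variable {B} (C : B.TauData)

/-! ## §2 The displays -/

/-- **«`τ(1/2) = [0]`»** (TYZ §3.2, the printed table of cusps), the cusp `[0]` of Tian Prop. 2.1 read in `A` through
TYZ's identification `i₀ : X₀(32) → A` (`∞ ↦ 0`). [cite: TianYuanZhang2017, §3.2 (p0012 L8–L18; J741)]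
[cite: Tian2014, Prop. 2.1 (p0006 L25–L27)] -/
def tyzTauHalf : Prop :=
  C.tau (1 / 2) = B.ptC0

/-- **Lemma 3.16 proof: «consider the two 2-isogenies `ϕ_F : A_F → E_F`, `[1+i] : A_F → A_F`. One checks that these two
morphisms have the same kernel `{0, τ(1)}`»**, on complex points: `ker ϕ = {0, τ(1)}` and `ker (1 + [i]) = {0, τ(1)}`, with
`[1+i] = [1] + [i]` the `ℤ[i]`-module structure of `A` («`A(ℍ′_n)` is a `ℤ[i]`-module», p0011 L66) and `ϕ` the isogeny of
degree `2` of J751. [cite: TianYuanZhang2017, Lemma 3.16 and its proof (p0017 L98–L113; J754), J751 (p0016 L45), p0011 L66] -/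
def tyzSameKernel : Prop :=
  (∀ a : B.A, B.phi a = 0 ↔ (a = 0 ∨ a = C.tau 1)) ∧
    (∀ a : B.A, a + B.iota a = 0 ↔ (a = 0 ∨ a = C.tau 1))

/-- The two printed sentences on `τ` together. [cite: TianYuanZhang2017, §3.2 (p0012 L16), Lemma 3.16 (p0017 L111)] -/
def TauDisplays : Prop :=
  C.tyzTauHalf ∧ C.tyzSameKernel

/-! ## §3 The kernel content: M7 is a theorem of the two sentences -/

/-- `2·[0] = τ(1)`: from «`τ(1/2) = [0]`» and the additivity of `τ`. [cite: TianYuanZhang2017, §3.2 (p0012 L16; J741)] -/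
theorem two_nsmul_ptC0_eq_tau_one (h : C.tyzTauHalf) : (2 : ℕ) • B.ptC0 = C.tau 1 := by
  rw [← h, two_nsmul, ← map_add]
  congr 1
  norm_num

/-- `[i]τ(1) = −τ(1)`: `τ(1) ∈ ker(1 + [i])`. [cite: TianYuanZhang2017, Lemma 3.16 proof (p0017 L111; J754)] -/
theorem iota_tau_one_eq_neg (h : C.tyzSameKernel) : B.iota (C.tau 1) = -C.tau 1 :=
  eq_neg_of_add_eq_zero_right ((h.2 (C.tau 1)).mpr (Or.inr rfl))

/-- `ϕ(τ(1)) = 0`: `τ(1) ∈ ker ϕ`. [cite: TianYuanZhang2017, Lemma 3.16 proof (p0017 L111; J754)] -/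
theorem phi_tau_one_eq_zero (h : C.tyzSameKernel) : B.phi (C.tau 1) = 0 :=
  (h.1 (C.tau 1)).mpr (Or.inr rfl)

/-- **Display M7 of the maximal bridge is a KERNEL THEOREM of the two printed sentences**:
`2·ϕ([i][0]) = ϕ([i](2·[0])) = ϕ([i]τ(1)) = ϕ(−τ(1)) = −ϕ(τ(1)) = 0`.
[cite: TianYuanZhang2017, §3.2 (p0012 L16; J741), Lemma 3.16 proof (p0017 L111; J754)] -/
theorem phiIotaCuspTwoTorsion_of_tauDisplays (h : C.TauDisplays) : B.phiIotaCuspTwoTorsion := by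
  unfold BridgeData.phiIotaCuspTwoTorsion
  rw [← map_nsmul, ← map_nsmul, C.two_nsmul_ptC0_eq_tau_one h.1, C.iota_tau_one_eq_neg h.2, map_neg,
    C.phi_tau_one_eq_zero h.2, neg_zero]

end TauData

/-! ## §4 The seven displays with M7 replaced by `τ` and its two printed sentences -/

/-- **The maximal displays with the cusp relation split into print**: M1–M6 of `CMPointSystemBridgeMaximal.lean` (Def. 2.7,
«`f` unique up to `−1`», `T(A) = t_{[0],−1}`, `T(B)` of exact order `4`, `z_N = f₀([i]P_N)`, `w = ϕ(z_N)`) and, in place of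
`2·ϕ([i][0]) = 0`, TYZ's uniformisation `τ` with «`τ(1/2) = [0]`» and «`ϕ_F` and `[1+i]` have the same kernel `{0, τ(1)}`».
[cite: Tian2014, Def. 2.7, Prop. 2.1, p0003 L1–L3] [cite: TianYuanZhang2017, §3.1, §3.2 (p0012 L16), J747, J751, Lemma 3.16 (p0017 L111)] -/
def CuspDisplays (w : EPoint D.H) : Prop :=
  B.tianDefZ ∧ B.fEqPhi ∧ B.tianTA ∧ B.tianTB ∧ B.tyzZN ∧ B.wEqPhiZN w ∧ ∃ C : B.TauData, C.TauDisplays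

/-- `CuspDisplays ⟹ MaximalDisplays` (M7 is a theorem of the two printed sentences on `τ`).
[cite: TianYuanZhang2017, §3.2 (p0012 L16), Lemma 3.16 (p0017 L111)] -/
theorem maximalDisplays_of_cuspDisplays {w : EPoint D.H} (h : B.CuspDisplays w) : B.MaximalDisplays w := by
  obtain ⟨h1, h2, h3, h4, h5, h6, C, hC⟩ := h
  exact ⟨h1, h2, h3, h4, h5, h6, C.phiIotaCuspTwoTorsion_of_tauDisplays hC⟩

end BridgeData

/-! ## §5 The Gross–Zagier relation with the cusp displays, and the restated system fact -/

/-- **The Gross–Zagier index relation with every bridge display a printed sentence**: as `GrossZagierMaximal`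
(TYZ Thm. 3.3 at `χ₀`, (B1) TYZ p. 749 through `ϕ`) with the seven displays replaced by `CuspDisplays` (M1–M6 and TYZ's
`τ` with its two printed sentences). [cite: TianYuanZhang2017, Thm. 3.3 (p. 739), p. 749, J751, §3.2, Lemma 3.16]
[cite: Tian2014, Def. 2.7, Prop. 2.1] -/
def GrossZagierCusp (D : CMPointData n) (hn : n ≠ 0) : Prop :=
  ∃ (R : EPoint D.H) (L u : ℤ) (h₂ : ℕ) (w : EPoint D.H) (B : D.BridgeData), IsScriptL (2 * n) L ∧
    IsScriptL 1 u ∧ Odd u ∧ D.tyzThm33Chi0 hn R L u h₂ ∧ D.tyzTwoRSum R w ∧ B.CuspDisplays w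

/-- `GrossZagierCusp ⟹ GrossZagierMaximal`. [cite: TianYuanZhang2017, §3.2 (p0012 L16), Lemma 3.16 (p0017 L111)] -/
theorem grossZagierMaximal_of_grossZagierCusp (D : CMPointData n) (hn : n ≠ 0) (h : D.GrossZagierCusp hn) :
    D.GrossZagierMaximal hn := by
  obtain ⟨R, L, u, h₂, w, B, hL, hu, huodd, h33, hB1, hC⟩ := h
  exact ⟨R, L, u, h₂, w, B, hL, hu, huodd, h33, hB1, B.maximalDisplays_of_cuspDisplays hC⟩

end CMPointData

/-- **THE SYSTEM FACT WITH EVERY BRIDGE DISPLAY A PRINTED SENTENCE**: Tian's CM-point system on `𝒮⁻` with `Printed`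
(Thm. 2.8 system), `GrossZagierCusp` (TYZ Thm. 3.3 at `χ₀` + TYZ p. 749 through `ϕ` + the displays M1–M6 of
`CMPointSystemBridgeMaximal.lean` + TYZ's uniformisation `τ` with «`τ(1/2) = [0]`» and «`ϕ_F` and `[1+i]` have the same
kernel `{0, τ(1)}`» + `𝓛(2n) ∈ ℤ`, `𝓛(1)` odd) and `GenusTheoryDisplays`. Existential over ONE system per `(p, q)`; implies
`tian2014_system_sMinus_maximal` (`tian2014_system_sMinus_maximal_of_cusp`), hence every enclosure form of the cell.
Printed-but-unproved content = that of the maximal fact with the computed sentence `2·ϕ([i][0]) = 0` replaced by the two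
printed sentences of TYZ §3.2 / Lemma 3.16.
[cite: Tian2014, Def. 2.7, Thm. 2.8 (p0011 L25–L44 = J132), Prop. 2.1 (p0006 L25–L75), p0003 L1–L3, (4.8) (p0023 L46–L50), Notations (J122–123)]
[cite: TianYuanZhang2017, Thm. 3.3 (p. 739) and its proof (pp. 749–751), §3.1, §3.2 (p0012 L8–L18), J747, J751, Lemma 3.16 (p0017 L98–L113), Thm. 1.1, Thm. 1.4] -/
def tian2014_system_sMinus_cusp : Prop :=
  ∀ p q : ℕ, (hp : p.Prime) → (hq : q.Prime) → p % 8 = 5 → q % 4 = 3 → jacobiSym p q = -1 →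
    ∃ D : CMPointData (p * q), D.Printed ∧
      D.GrossZagierCusp (Nat.mul_ne_zero hp.ne_zero hq.ne_zero) ∧ D.GenusTheoryDisplays

/-- The cusp fact implies the maximal fact (M7 is a kernel theorem of TYZ's two printed sentences on `τ`).
[cite: TianYuanZhang2017, §3.2 (p0012 L16), Lemma 3.16 (p0017 L111)] [cite: Tian2014, Def. 2.7, Prop. 2.1] -/
theorem tian2014_system_sMinus_maximal_of_cusp (h : tian2014_system_sMinus_cusp) :
    tian2014_system_sMinus_maximal := by
  intro p q hp hq hp5 hq4 hj
  obtain ⟨D, hP, hG, hGen⟩ := h p q hp hq hp5 hq4 hj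
  exact ⟨D, hP, D.grossZagierMaximal_of_grossZagierCusp _ hG, hGen⟩

end Literature.NumberTheory.EllipticCurves.Tian2014

end
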